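import Mathlib
import HarnessLib
import HarnessLib.Audit
import Summits.MatrixMultiplication.Statement
import Literature.Computability.AlgebraicComplexity.GroupTheoreticMatMul
import Literature.Computability.AlgebraicComplexity.GroupTheoreticMatMulProofs
import Literature.Computability.AlgebraicComplexity.FlatteningBound

/-!
Route: AlgebraicSTPPDichotomy

CLOSED (refuted) 2026-08-15T23:19:54Z by planner-rrefute-MatrixMultiplication-Algebraic-7b2f89ab-0 — reason: refuted:stmt-MatrixMultiplication-9721 (ExactFrameDesign) by AlgebraicSTPPDichotomyExactFrameDesign_refuted — note: CLOSED REFUTED per the route's own kill criterion ('FrameBarrier proved ⇔ target refuted ⇒ close refuted:ExactFrameDesign, barrier as catalogue entry'): TARGET ExactFrameDesign (9721) refuted by AlgebraicSTPPDichotomyExactFrameDesign_refuted @968c9d9e7f0e (p69657) — FrameBarrier's body is verbatim L. The file is kept as the record of this route; refuted decls are indexed as negative knowledge (`ledger negatives`).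

# Route AlgebraicSTPPDichotomy — bounded-rank STPP frame designs over F_q — dimension-exact design
gives omega = 2, else a bounded-rank companion of Thm B (Lang–Weil dichotomy, linear layer typed)

X = EXACT FRAME DESIGN in bounded rank (card algebraic-stpp-dimension-dichotomy; the DECIDING side
of the dichotomy since the D-0027 repair of 2026-08-15, positive form of ¬FrameBarrier): some rank m
such that for every ε > 0 and arbitrarily large finite fields F there is an STPP family
(CohnKleinbergSzegedyUmans2005 Def 5.1 = tree `IsSTPP`) whose sets are PUNCTURED SUBSPACES V∖{0} of
F^m ("frames") with Σ_i (|A_i||B_i||C_i|)^{(2+ε)/3} > |F|^m. It suffices: X → ω(ℂ) = 2 is this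
route's deciding theorem `closes` (sorry-free in the route file; its type is the item Assembly):
CKSU Thm 5.5, abelian case — PROVED in the tree as `CohnKleinbergSzegedyUmans2005_5_5_abelian_holds`
— applied in H = F^m with ε = ω − 2, plus the flattening bound `omega_two_le`. In the card's
language: with |V∖0| = q^d − 1 the CKSU inequality is dimension arithmetic; a frame design with q^e
blocks of dimensions (d_A,d_B,d_C), v = d_A+d_B+d_C, certifies exactly the rational w_inf = 3(m−e)/v
≥ 2 (packing, BlasiakChurchCohnGrochowNaslundSawinUmans2017 Lemma 2.4 = tree `IsSTPP.packing`), and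
X asks for a DIMENSION-EXACT design (e + 2v/3 = m up to q^{o(1)}: packing-saturating, heavily
overlapping frames). Its line case d = (1,1,1) is the construction crux ExactLineDesign (N ≥
q^{m−2−δ} STPP triples of punctured lines; first candidate home m = 6 over prime fields, where
generic triples are good and the norm-one torus ker(N: F_{q^6}^× → F_{q^2}^×) already packs one of
the three pairings perfectly); Thm B (tree, proved) forces char F → ∞ along any witness sequence,
which bounded RANK allows. The route is TWO-SIDED by construction: ¬X is the FRAME BARRIER (crux
FrameBarrier; `FrameBarrier ↔ ¬X` is the support FrameBarrierIffNotExact): for every m there are ε_m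
> 0 and q₀ such that every STPP frame family in F^m, |F| ≥ q₀, obeys Σ_i
(|A_i||B_i||C_i|)^{(2+ε_m)/3} ≤ |F|^m — a power saving over the packing bound. FrameBarrier proved
REFUTES the target and closes this route `refuted` with a new catalogue entry in hand — the
bounded-RANK companion, for frame and (crux DefinableDesignBarrier) definable designs, of the
bounded-EXPONENT `TricoloredSumFreeBarrier` — retiring every subspace / polynomial-matrix /
finite-geometry proposal for `GroupTheoreticSTPP.CPackingConstruction`
(stmt-MatrixMultiplication-0595) in the regime m fixed, q → ∞, which Pratt2024 (arXiv:2309.03878 p.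
9, Cor 4.5) treats only conditionally on Val(ℤ_n) ≤ n^{1+o(1)} (Conj 4.1).
Lean: `∃ m : ℕ, ∀ ε : ℝ, 0 < ε → ∀ q₀ : ℕ, ∃ (F : Type) (_ : Field F) (_ : Fintype F), q₀ ≤
Fintype.card F ∧ ∃ (N : ℕ) (V W U : Fin N → Submodule F (Fin m → F)) (A B C : Fin N → Finset (Fin m
→ F)), (∀ i v, v ∈ A i ↔ v ∈ V i ∧ v ≠ 0) ∧ (∀ i v, v ∈ B i ↔ v ∈ W i ∧ v ≠ 0) ∧ (∀ i v, v ∈ C i ↔ v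
∈ U i ∧ v ≠ 0) ∧ Literature.Computability.AlgebraicComplexity.IsSTPP A B C ∧ (Fintype.card F : ℝ) ^
m < ∑ i, (((A i).card * (B i).card * (C i).card : ℕ) : ℝ) ^ ((2 + ε) / 3)`

## Assembly
The deciding theorem `closes : ExactFrameDesign → MatrixMultiplication` (landed rev 5; the Assembly
item is its type) is the KILL LINK of the dichotomy, pure logic over two PROVED tree theorems: ω ≥ 2
is `omega_two_le`; if ω > 2, feed ε = ω − 2 to X and get a finite field F and an STPP frame family
in H = F^m with Σ(|A_i||B_i||C_i|)^{ω/3} > |F|^m = |H|, contradicting CKSU Thm 5.5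
(`CohnKleinbergSzegedyUmans2005_5_5_abelian_holds`); hence ω(ℂ) = 2 = `MatrixMultiplication` (14
tactic lines; axioms propext, Classical.choice, Quot.sound). Around it (all supports, provable now):
ExactLineDesign → X (LineDesignToExact); X → SubcubicFrameFamily (ExactToSubcubic); FrameBarrier ↔
¬X (FrameBarrierIffNotExact). The barrier side refuting X is what the negative cruxes build:
DefinableDesignBarrier → AlgebraicFrameBarrier ← FrameBarrier → LineFrameBarrier (FrameToLine),
¬SubcubicFrameFamily → FrameBarrier (NotSubcubicToBarrier), and ¬DefinableDesignBarrier → ω = 2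
(DefinableKillLink).

Rationale: WHY THIS LINE. Mechanism (card algebraic-stpp-dimension-dichotomy, graded new-combination): over F_q
with q → ∞ and rank m fixed, point counting (LangWeil1954; ChatzidakisVanDenDriesMacintyre1992 main
theorem: |φ(F_q)| = μq^d + O(q^{d−1/2}) from a finite menu of (μ,d)) turns the Cohn–Umans inequality
Σ(|A_i||B_i||C_i|)^{ω/3} ≤ |H| (CohnKleinbergSzegedyUmans2005 Thm 5.5, proved in tree) into
dimension arithmetic, so ω = 2 from such designs is a problem of EXCESS INTERSECTION (the bad
variety of sextuples must lose dimension m − v/3), and the STPP cross-conditions for frames become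
linear algebra: a pair/triple of blocks is good iff the dependency space of ≤ 6 subspaces avoids the
complement of a few coordinate hyperplanes, and a subspace over F_q lies in a union of k hyperplanes
only if it lies in one (q ≥ k) — the POINTWISE ENGINE, which already closes m = 3 (≤ 2 full blocks;
CKSU's §5 example is the extremiser) and (plane, line, line) in F^4 (≤ 2 blocks) by hand. Two
regimes then appear (this route's own contribution to the card): for big frames (5d > m) generic
pairs are BAD, so an STPP family is a clique in an algebraic graph with Zariski-closed edge set and
lies on a bounded-complexity subvariety on which one degeneracy holds GLOBALLY (the card's
irreducibility upgrade: the algebraic case IS the general case there); for small frames (6d ≤ m)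
generic triples are GOOD and dimension-exactness is a finite-geometry packing problem (three
mutually indexed near-spreads; the norm-one torus ker(N: F_{q^6}^× → F_{q^2}^×) already packs one of
the three pairings perfectly for lines in F^6), the one place a construction could live. Imported:
model theory / arithmetic geometry of finite fields (CDM, Lang–Weil, Tao2015AlgebraicRegularity) for
the definable layer; finite geometry (spreads, arcs/MDS-type rigidity) for the small-frame regime;
additive combinatorics only through the tree's packing lemma. What prior routes and the literature
do not do: GroupTheoreticSTPP stakes the construction (0595) and the all-abelian uniform obstruction
(0596); Pratt2024 makes bounded rank conditional on Val(ℤ_n) ≤ n^{1+ε}; BCCGNSU Thm B needs bounded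
exponent (here the slice-rank constant only saves 0.84^m, no power of q); this line restricts the
DESIGN class instead of the group class and gets unconditional, decidable-by-linear-algebra
statements: the target is the construction (its success IS ω = 2 through the deciding theorem
`closes`), its negation the barrier. Negatives index: empty at filing; the refuted CARD
definable-design-barrier ('no definable family certifies any ω < 3', killed by CKSU's F_p^3 example
at finite p) is avoided: every statement here is at power level with q ≥ q₀ and exponent 2+ε, which
that example satisfies (w_inf = 3).

RANKED CRUXES. #0 ExactFrameDesign (target) — X as in § Thesis: some m such that for every ε > 0 and
arbitrarily large finite F an STPP family of punctured-subspace frames in F^m has Σ_i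
(|A_i||B_i||C_i|)^{(2+ε)/3} > |F|^m (a dimension-exact frame design in bounded rank); decides the
summit through `closes`. (why it might fail: FrameBarrier (= ¬X) may simply hold — every closed case
has O(1) full blocks (m = 3: ≤ 2; lines in F^4: exactly 3 for q = 3, 4, 5, refuter census on
stmt-7622), big frames 5d > m force cliques in a Zariski-closed bad-pair graph, and over prime
fields a witness family would give Val(ℤ_n) ≥ Ω(n^{1+c}), refuting Pratt2024 Conj 4.1 (Cor 4.5).)
[CohnKleinbergSzegedyUmans2005, BlasiakChurchCohnGrochowNaslundSawinUmans2017,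
BlasiakCohnGrochowPrattUmans2023, Pratt2024,
lean:Literature.Computability.AlgebraicComplexity.CohnKleinbergSzegedyUmans2005_5_5_abelian_holds]
#2 ExactLineDesign (crux) — the CONSTRUCTION, line case d = (1,1,1) of X in counting form: some m
such that for every δ > 0 and arbitrarily large finite F there are N ≥ |F|^{m−2−δ} triples of
punctured lines (F^×a_i, F^×b_i, F^×c_i) in F^m forming an STPP family (packing allows N ≲ q^{m−2}:
three mutually indexed near-spreads). First candidate home m = 6 over prime fields (generic triples
good; the torus ker(N: F_{p^6}^× → F_{p^2}^×) packs one pairing perfectly); m = 4, 5 are clique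
problems in the Zariski-closed bad-pair graph. Implies X (support LineDesignToExact). Hardest and
most informative. [difficulty: open-problem] (why it might fail: LineFrameBarrier may hold — m = 3
has ≤ 2 blocks, lines in F^4 have exactly 3 blocks for q = 3, 4, 5 (refuter census), a random family
in F^6 has ~q^6 bad pairs at N = q^4, and no packing-saturating STPP design is known in abelian
groups of bounded rank (BCGPU2023 p. 4: none even in groups of Lie type; TPP ones exist, Cohn–Umans
2003).) [CohnKleinbergSzegedyUmans2005, BlasiakChurchCohnGrochowNaslundSawinUmans2017,
BlasiakCohnGrochowPrattUmans2023, Pratt2024,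
lean:Literature.Computability.AlgebraicComplexity.IsSTPP.packing]
#2 AlgebraicFrameBarrier (crux) — card Crux 1 (linear case) in counting form, the case where the
irreducibility engine applies: for bounded-degree polynomial frame families over F — index set the
F-points of a basic open {f = 0, g ≠ 0} ⊂ A^e, sets the punctured column spans of polynomial
matrices M_A(x), M_B(x), M_C(x) — STPP on ALL index points forces Σ_x (|A_x||B_x||C_x|)^{(2+ε)/3} ≤
|F|^m for |F| ≥ q₀, with ε, q₀ depending only on (degree, e, m, d_A, d_B, d_C, r): no
dimension-exact ALGEBRAIC frame design. Implied by FrameBarrier and by DefinableDesignBarrier;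
equivalent to FrameBarrier in the big-frame regime 5d > m via the clique-to-subvariety reduction
(layer 2); its refutation is an explicit algebraic witness of X. [difficulty: open-problem] (why it
might fail: The global-degeneracy cascade is closed only for m = 3 and (2,1,1) in F^4; from (m,d,e)
= (4,1,2), (5,1,3), (6,2,2) on a parametrised degenerate-but-consistent configuration may exist —
and would give ω = 2.) [CohnKleinbergSzegedyUmans2005, ChatzidakisVanDenDriesMacintyre1992,
Tao2015AlgebraicRegularity, LangWeil1954]
#3 FrameBarrier (crux, the NEGATIVE SIDE ¬X; ledger rank 0 kept from its time as target) — for every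
m, some ε_m > 0 and q₀ such that every STPP family of punctured-subspace frames in F^m, |F| ≥ q₀,
has Σ_i (|A_i||B_i||C_i|)^{(2+ε_m)/3} ≤ |F|^m (no dimension-exact frame design in bounded rank);
proved, it refutes the target (FrameBarrierIffNotExact) and is the proposed bounded-RANK catalogue
entry; at fixed characteristic it is Thm B (tree), so its open content is uniformity as char F → ∞.
(why it might fail: A dimension-exact frame design may exist — q^3 STPP line-triples in F_q^5, or
q^4 in F_q^6 where generic triples are good and a norm-one torus already packs one of the three
pairings perfectly; any such family gives ω = 2 through closes.) [CohnKleinbergSzegedyUmans2005,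
BlasiakChurchCohnGrochowNaslundSawinUmans2017, Pratt2024,
lean:Literature.Computability.AlgebraicComplexity.IsSTPP.packing]
#3 LineFrameBarrier (crux) — the d = (1,1,1) case of FrameBarrier for ALL families (=
¬ExactLineDesign up to the δ/ε bookkeeping): for every m some ε_m > 0, q₀ with Σ_i
(|A_i||B_i||C_i|)^{(2+ε_m)/3} ≤ |F|^m for every STPP family of punctured LINES in F^m, |F| ≥ q₀;
i.e. at most q^{m−2−δ} STPP line-triples (packing allows q^{m−2}). m = 3 is RankThreeNoGo; m = 4
looks closed for trivial reasons (exactly 3 blocks for q = 3, 4, 5, refuter census); first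
informative numerologies (5,1,3) (big-frame regime, cliques under 6-vector degeneracies), then m ≥ 6
(spread regime). [deps: RankThreeNoGo] [difficulty: L] (why it might fail: m = 4, 5 need a power
saving for cliques of line-triples under 5- and 6-vector coplanarity constraints (open); for m ≥ 6
generic triples are GOOD and q^(m−2) blocks is a packing question where a field-extension torus
already packs one of the three pairings perfectly.) [CohnKleinbergSzegedyUmans2005,
BlasiakChurchCohnGrochowNaslundSawinUmans2017, Pratt2024]
#4 SubcubicFrameFamily (crux) — POSITIVE RESIDUE (card Crux 3), existential and a necessary waypoint
of X (ExactToSubcubic): some m and τ ∈ [2,3) such that for arbitrarily large finite fields F there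
is an STPP frame family in F^m with Σ_i (|A_i||B_i||C_i|)^{τ/3} ≥ |F|^m — a bounded-rank
group-theoretic certificate below 3 at POWER level (CKSU's e = 0 designs reach only w_inf = 3; this
needs index growth q^e with e > m − v, heavily overlapping frames). Two-sided: a witness is the
first such certificate and locates inf Spec(w_inf); its negation proves FrameBarrier outright
(NotSubcubicToBarrier) and hence refutes the target. [difficulty: L] (why it might fail: Every
closed case has O(1) full blocks (m = 3: ≤ 2; (2,1,1) in F^4: ≤ 2; lines in F^4: 3), e = 0 designs
give w_inf ≥ 3, and no packing-saturating STPP design is known in any abelian group of bounded rank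
or exponent (BCGPU2023 p. 4; Thm B) — the frame spectrum may be {3}.)
[CohnKleinbergSzegedyUmans2005, BlasiakCohnGrochowPrattUmans2023,
BlasiakChurchCohnGrochowNaslundSawinUmans2017]
#5 DefinableDesignBarrier (crux) — the card's full layer (its Crux 2 folded in): for ring-language
formulas φ_I(x;y), φ_A, φ_B, φ_C(x,v;y) (parameters y ∈ F^k) there are ε > 0, q₀ such that in every
finite field F with |F| ≥ q₀ and for every parameter value, if the definable family (A_x, B_x,
C_x)_{x ∈ I(F)} ⊂ F^m is STPP on all of I(F) then Σ_{x∈I(F)} (|A_x||B_x||C_x|)^{(2+ε)/3} ≤ |F|^m.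
Route to it: CDM main theorem makes the count dimension arithmetic; dimension-exactness forces
maximal degeneracy of the bad variety; a coset theorem (group configuration / Breuillard–Green–Tao /
Tao's algebraic regularity lemma) should reduce exact definable designs to frames, i.e. to
AlgebraicFrameBarrier. Covers tori (F^×)^d and CKSU §7 local designs, which frames do not; its
refutation gives ω = 2 directly (DefinableKillLink). [deps: AlgebraicFrameBarrier] [difficulty: XL]
(why it might fail: The coset step is conjectural: a definable non-coset design (tori minus
hypersurfaces, norm-one sets, quadratic-residue patterns) could be dimension-exact where frames are
not; CDM densities μ < 1 only enter at w_inf itself.) [ChatzidakisVanDenDriesMacintyre1992,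
Tao2015AlgebraicRegularity, CohnKleinbergSzegedyUmans2005, arXiv:1005.1881]
#1 Assembly (assembly, restated rev 5) — ExactFrameDesign → MatrixMultiplication: literally the type
of `closes`, provable now by `fun h => closes h`. [difficulty: provable-now]
[CohnKleinbergSzegedyUmans2005,
lean:Literature.Computability.AlgebraicComplexity.CohnKleinbergSzegedyUmans2005_5_5_abelian_holds,
lean:Literature.Computability.AlgebraicComplexity.omega_two_le]
#9 RankThreeNoGo (support) — provable now (hand proof in planner NOTES.md; refuter-verified
exhaustively for q ≤ 13, evidence on stmt-7625; sharp by CKSU arXiv text p. 9 Prop 28): over a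
finite field with |F| ≥ 5, an STPP family of punctured-subspace frames in F^3 has at most 2 blocks
with all three sets non-empty (patterns (x,x,y), (x,y,y), (x,y,x) force the plane-triples of two
full blocks to be cyclic rotations of each other; three rotations violate the all-distinct pattern;
the pointwise engine is Mathlib `Submodule.iUnion_ssubset_of_forall_ne_top_of_card_lt`). Gives
LineFrameBarrier and FrameBarrier at m = 3 with any ε_3 ≤ 1/2. [difficulty: provable-now]
[CohnKleinbergSzegedyUmans2005]
#9 NotSubcubicToBarrier (support) — glue, provable now (candidate proof attached by grounder
g15-22): ¬SubcubicFrameFamily → FrameBarrier (take τ = 5/2, ε = 1/2; push the negation through and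
compare exponents). [difficulty: provable-now] [CohnKleinbergSzegedyUmans2005]
#9 FrameToLine (support) — glue, provable now (candidate proofs attached): FrameBarrier →
LineFrameBarrier (a punctured line {t • a : t ≠ 0} is the punctured span F∙a;
`Submodule.mem_span_singleton`). [difficulty: provable-now] [CohnKleinbergSzegedyUmans2005]
#9 DefinableKillLink (support) — provable now, the kill link of the definable layer: CKSU Thm 5.5
(tree fact, proved) → ¬DefinableDesignBarrier → ω(ℂ) = 2 (re-index I(F) by Fin |I|, take ε = ω − 2,
|F^m| = |F|^m, `omega_two_le`; same 14 lines as closes). [difficulty: provable-now]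
[CohnKleinbergSzegedyUmans2005,
lean:Literature.Computability.AlgebraicComplexity.CohnKleinbergSzegedyUmans2005_5_5_abelian_holds]
#9 LineDesignToExact (support) — glue, provable now: ExactLineDesign → ExactFrameDesign (V_i =
F∙a_i; |A_i| = |B_i| = |C_i| = |F| − 1; given ε take δ = ε/2 and q₀ with |F| > 2^{2(2+ε)/ε}).
[difficulty: provable-now] [CohnKleinbergSzegedyUmans2005]
#9 FrameBarrierIffNotExact (support) — bookkeeping, provable now (push_neg, not_lt): FrameBarrier ↔
¬ExactFrameDesign; a proof of FrameBarrier is a one-line refutation of the target. [difficulty: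
provable-now] [CohnKleinbergSzegedyUmans2005]
#9 ExactToSubcubic (support) — bookkeeping, provable now: ExactFrameDesign → SubcubicFrameFamily
with τ = 5/2 (ε = 1/2; < gives ≤). [difficulty: provable-now] [CohnKleinbergSzegedyUmans2005]

TWO-LAYER PLAN. Foreseen glued splits (none filed now): ExactFrameDesign ⇐ ExactLineDesign (glue
LineDesignToExact, both filed at top level) and, should LineFrameBarrier be proved, a
higher-dimensional child (m,d) = (6,2) or (9,3) (frames of planes/solids, N ~ q^{m−2d}) with the
analogous glue; ExactLineDesign ⇐ per-rank children m = 6 (spread regime) | m = 5 (clique regime).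
FrameBarrier ⇐ BigFrameReduction → SpreadRegime → FrameBarrier (BigFrameReduction: for 5d > m an
STPP frame family lies, up to O_m(1) points, on a bounded-complexity subvariety of the frame variety
on which STPP holds for all points, so AlgebraicFrameBarrier gives the bound; SpreadRegime: for 6d ≤
m three mutually indexed near-spreads of 2d-spaces indexed by q^(m−2d) blocks have a power deficit).
AlgebraicFrameBarrier ⇐ CascadeClosure per numerology, first children (m,d,e) = (4,1,2), (5,1,3),
(6,2,2) (Gröbner-checkable). DefinableDesignBarrier ⇐ CosetTheorem (dimension-exact definable design
⇒ sets are finite unions of cosets of algebraic subgroups up to lower-dimensional error) →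
AlgebraicFrameBarrier → DefinableDesignBarrier.

KILL CRITERIA. FrameBarrier proved (⇔ target refuted, FrameBarrierIffNotExact) ⇒ close
refuted:ExactFrameDesign — the honest negative outcome, with the bounded-rank frame barrier as
catalogue entry (hand the proof to Literature/Barriers and to GroupTheoreticSTPP, stmt-0595/0596).
¬SubcubicFrameFamily proved ⇒ same via NotSubcubicToBarrier. LineFrameBarrier proved ⇒
ExactLineDesign refuted: pivot the construction to plane/solid frames ((6,2), (9,3)) or to the
definable layer (tori, CKSU §7 local designs), else close refuted. ExactLineDesign or
ExactFrameDesign proved ⇒ ω(ℂ) = 2 lands through closes (and the family is handed to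
GroupTheoreticSTPP.CThesis, stmt-0593). DefinableDesignBarrier refuted ⇒ ω = 2 through
DefinableKillLink (file the witness as the target of a successor route if it is not a frame).
AlgebraicFrameBarrier refuted ⇒ an explicit algebraic witness of X: promote it to the target at
once. SubcubicFrameFamily proved with τ close to 2 ⇒ re-rank toward the construction numerology it
exhibits. Proved elsewhere: GroupTheoreticSTPP.CAbelianObstructionNeg (stmt-0596, uniform ε over all
abelian groups) implies FrameBarrier ⇒ close refuted:ExactFrameDesign (superseded on the barrier
side); CThesis (stmt-0593) proved ⇒ ω = 2, route moot.

NOT DECOMPOSED YET. The exact inverse theorem for the coset step (Breuillard–Green–Tao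
arXiv:1005.1881 vs group configuration vs Tao2015AlgebraicRegularity) and the CDM densities μ; tori
(F^×)^d and CKSU §7 local USP designs inside the definable layer (not frames); frames with extra
deletions inside blocks (subspace minus lower-dimensional subspaces: conical designs) — covered only
by crux 5; p-dependent bounded-complexity subvarieties with coefficients outside the prime field
(covered by FrameBarrier for frames, by the parameters y in crux 5); unbounded rank, bounded
exponent (TricoloredSumFreeBarrier's regime) and non-abelian hosts (other routes); the value of ε_m
(conjecturally ≥ c/m).

CHEAPEST FALSIFIER. A census of N(q) := the maximum number of STPP punctured-line triples in F_q^m: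
the target side needs N(q) ≥ q^{m−2−δ} somewhere, FrameBarrier predicts N(q) ≤ C q^{m−2−δ'}, and
N(q) = O(1) would suggest the frame spectrum is {3}. EXECUTED (refuter route-review 2026-08-15,
evidence on stmt-7622/7625): m = 3: ≤ 2 blocks for all q ≤ 13 (exactly the two cyclic rotations;
RankThreeNoGo sharp by CKSU Prop 28); m = 4: N(3) = N(4) = N(5) = 3 exactly (packing q² = 9, 16, 25)
— the (4,1) numerology is closed for trivial reasons. NEXT CHEAPEST (kit): the same exact/ILP/SAT
census at (m,d) = (5,1) for q ≤ 5 and a greedy/random clique search at (6,1), q ∈ {5, 7, 8, 9, 11}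
(the claimed first home of ExactLineDesign: anything ≫ q² blocks there is news, O(1) kills the line
case); plus Gröbner elimination of the (4,1,2)/(5,1,3) cascades for polynomial line-frame families
of degree ≤ 2 (AlgebraicFrameBarrier).

NUMBERS. CKSU2005 §5 example (arXiv:math/0511460 p. 9, Prop 28): m = 3, e = 0, two blocks of
punctured coordinate lines, 2(q−1)^ω ≤ q^3, i.e. w_inf = 3 with the constant giving ω < 2.93 at
finite q — satisfies every statement here (ε_3 = 1/2 works for all q). Packing (BCCGNSU Lemma 2.4,
tree IsSTPP.packing): N ≤ q^(m−2v/3); exact numerologies have d_A = d_B = d_C = d and N ~ q^(m−2d):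
(m,d) = (3,1) dead (≤ 2 blocks), (4,1): q^2 — dead in practice (N = 3 for q = 3, 4, 5), (5,1): q^3,
(6,1): q^4, (6,2): q^2, (9,3): q^3. Regimes: generic pairs bad iff 5d > m (two random blocks already
conflict); generic triples good iff 6d ≤ m (there random families are STPP up to N ~ q^(1/3) by the
union bound, far below q^(m−2d)). Thm B at exponent p saves only (c_p/p)^m → 0.8415^m, no power of q
(refuter triage-20). Sub-exact numerologies with w_inf < 3 need e > m − v: smallest (4,(2,1,1),1) →
2.25 — dead (≤ 2 blocks, hand); (5,(2,2,1),1) → 2.4; (6,(2,2,2),1) → 2.5. Print, page-verified by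
grounders: BlasiakCohnGrochowPrattUmans2023 (arXiv:2204.03826) p. 3 knows of no construction 'in
finite groups of Lie type' meeting even the packing bound and p. 4 recalls Cohn–Umans 2003 TPP
families MEETING it — so the correct statement is that no packing-saturating STPP design is known in
abelian groups of bounded rank or bounded exponent (the earlier paraphrase 'in any group' was too
strong); Pratt2024 p. 9: Conj 4.1 (Val(ℤ_n) ≤ O(n^{1+ε})), Thm 4.4, Cor 4.5 (ω = 2 from STPP in
abelian groups with boundedly many direct factors ⇒ Val(ℤ_n) ≥ Ω(n^{1+c})). Items after the repair:
15 (target ExactFrameDesign; 6 cruxes ExactLineDesign, AlgebraicFrameBarrier, FrameBarrier,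
LineFrameBarrier, SubcubicFrameFamily, DefinableDesignBarrier; 7 supports; Assembly) — at the cap;
growth only by glued splits.

DEFINITION REQUESTS. None for the typed items (IsSTPP, Submodule, MvPolynomial, Matrix.mulVecLin,
FirstOrder.Language.ring.Formula / FirstOrder.Ring.CompatibleRing are in tree / Mathlib). Cite fact
wanted for provers of crux 5: ChatzidakisVanDenDriesMacintyre1992 main theorem (definable sets over
finite fields have |φ(F_q,y)| ∈ {μ q^d + O(q^(d−1/2))} for finitely many (μ,d) depending on φ only)
as a named Literature fact; LangWeil1954 Thm 1 likewise (bib entry supplied in planner folder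
langweil.bib if the key is missing).

Novelty: Searches (2026-08-15): `lit frontier MatrixMultiplication --since 2020` (30 rows; none on STPP
designs over F_q, q → ∞); `lit bridges MatrixMultiplication --cross any` (30 rows; no paper joining
the CKSU roots to finite-field model theory or finite geometry); `lit search --source zbmath "triple
product property matrix multiplication"` (8: Neumann2011, Hedtke2011, Hedtke–Murthy 2012,
Hart–Hedtke–Müller-Hannemann 2015, Hedtke 2015, BCGPU2025 — computer searches for TPP triples in
SMALL groups, none parametrised by q); `lit search --source crossref "simultaneous triple product
property abelian group construction matrix multiplication"` (20; adds Lai–Zhou–Xiang 2016 ant-colony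
TPP search); `lit galaxy search "simultaneous triple product property" --star all` (5: CKSU05 pdf,
Sawin arXiv:1702.00905, Stothers' thesis ×2, Landsberg's GCT book); `lit read arxiv:math/0511460`
(Def 27 / Prop 28 / Thm 31 = Def 5.1 / §5 example / Thm 5.5 read on pp. 8–9); `lit read
arxiv:2309.03878` (p. 3: bounded number of direct factors 'not studied before as far as we are
aware'; Conj 4.1, Thm 4.4, Cor 4.5 on p. 9); the 25 route files of the sub (only GroupTheoreticSTPP
touches STPP) and `ledger negatives` (empty).
Nearest prior art found: CohnKleinbergSzegedyUmans2005 (arXiv:math/0511460: Def 5.1, Thm 5.5, the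
F_p^3 example = our m = 3 extremiser, §7 local designs at e = 0); Pratt2024 (arXiv:2309.03878 Cor
4.5: bounded rank conditional on Val(ℤ_n)); BlasiakChurchCohnGrochowNaslundSawinUmans2017 (arXiv  [refs: 1702.00905, math/0511460, 2309.03878, 1605.06702, arxiv:math/0511460, arxiv:2309.03878, Neumann2011, Hedtke2011, CohnKleinbergSzegedyUmans2005, Pratt2024, BlasiakChurchCohnGrochowNaslundSawinUmans2017, ChatzidakisVanDenDriesMacintyre1992, LangWeil1954]

Barriers (technique_class: group-theoretic-approach, abelian-STPP, definable-designs): - technique_class: group-theoretic-approach, abelian-STPP, definable-designs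
- Literature.Barriers.MatrixMultiplication.TricoloredSumFreeBarrier: APPLIES to the target at fixed
characteristic and is evaded by hypothesis — Thm B (tree:
BlasiakChurchCohnGrochowNaslundSawinUmans2017_B_holds, `not_beats_of_exponent_le`) needs exponent ≤
ℓ, and H = F^m has exponent char F, so a witness sequence for ExactFrameDesign (ε → 0) must have
char F → ∞ (prime fields F_p, p → ∞), which bounded RANK m allows (the barrier's own evasions_known:
unbounded exponent); at fixed char the barrier simply PROVES the negative statements (consistent);
the slice-rank constant saves 0.84^m, no power of q, so it can neither kill X over prime fields nor
prove FrameBarrier: FrameBarrier is the proposed bounded-RANK companion entry.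
- Literature.Barriers.MatrixMultiplication.EquivoluminousBarrier: n/a — no CW-type 'no three
disjoint equivoluminous subsets' hypothesis is used; designs here are frames over F_q with q → ∞,
outside the sunflower/cap-set regime.
- Literature.Barriers.MatrixMultiplication.NilpotentGroupBarrier: hosts are abelian (class 1);
beyond Thm B it says nothing at unbounded exponent; n/a.
- Literature.Barriers.MatrixMultiplication.NormalizerBarrier: concerns TPP triples of SUBGROUPS with
large normalisers in non-abelian groups; our sets are punctured subspaces (not subgroups: 0 removed,
STPP not TPP) in abelian hosts; n/a.
- Literature.Barriers.MatrixMultiplication.QuasirandomBarrier: non-ab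

History (route lifecycle, newest last):
- 2026-08-15T16:13:56Z · rev 5: restated Assembly (stmt-MatrixMultiplication-7629) — route-repair (D-0027 glue): deciding theorem `closes : ExactFrameDesign → MatrixMultiplication` supplied (sorry-free, axioms propext/Classical.choice/Quot.sound (planner-rbadge-MatrixMultiplication-AlgebraicS-4f642669-g2-0)
- 2026-08-15T23:07:15Z · BROKEN — ExactLineDesign (stmt-MatrixMultiplication-9732, crux) refuted by Summit.MatrixMultiplication.MatrixMultiplication.Theorems.AlgebraicSTPPDichotomyExactLineDesign_refuted @ 4274edbc8f06 (refuter-cdisprove-stmt-MatrixMultiplication-9732-0)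
- 2026-08-15T23:17:24Z · BROKEN — ExactFrameDesign (stmt-MatrixMultiplication-9721, target) refuted by AlgebraicSTPPDichotomyExactFrameDesign_refuted @ 968c9d9e7f0e (refuter-cdisprove-stmt-MatrixMultiplication-7621-0)
- 2026-08-15T23:19:54Z · CLOSED refuted — refuted:stmt-MatrixMultiplication-9721 (ExactFrameDesign) by AlgebraicSTPPDichotomyExactFrameDesign_refuted (planner-rrefute-MatrixMultiplication-Algebraic-7b2f89ab-0)

sub-problem: MatrixMultiplication · status: closed(refuted) · opened planner-plancard-MatrixMultiplication-MatrixM-fc8842a8-0 2026-08-15T12:13:00Z · rev 8 · ledger route-MatrixMultiplication-AlgebraicSTPPDichotomy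
GENERATED by the gate from the ledger (D-0016/17). Provers cite these decls: `theorem foo : Summit.MatrixMultiplication.MatrixMultiplication.Theses.AlgebraicSTPPDichotomy.<Decl> := …` in Summits/MatrixMultiplication/MatrixMultiplication/Theorems/<Name>.lean.
-/

namespace Summit.MatrixMultiplication.MatrixMultiplication.Theses.AlgebraicSTPPDichotomy

open scoped BigOperators Topology Manifold Classical MeasureTheory ProbabilityTheory Matrix InnerProductSpace ComplexConjugate ContinuousMap
open Filter Set Function TopologicalSpace MeasureTheory

attribute [summit_statement] _root_.MatrixMultiplication

/-- item stmt-MatrixMultiplication-7620 · crux · rank 0 · closed · moot by None · by planner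
why it might fail: A dimension-exact frame design may exist — q^3 STPP line-triples in F_q^5, or q^4 in F_q^6 where generic triples are good and a norm-one torus already packs one of the three pairings perfectly ((4,1) is dead in practice: N = 3 for q ≤ 5); any such family gives ω = 2 through closes.
sources: CohnKleinbergSzegedyUmans2005, BlasiakChurchCohnGrochowNaslundSawinUmans2017, Pratt2024, lean:Literature.Computability.AlgebraicComplexity.IsSTPP.packing
[target] X as in § Thesis: for every m, some ε_m > 0 and q₀ such that every STPP family of
punctured-subspace frames in F^m, |F| ≥ q₀, has Σ_i (|A_i||B_i||C_i|)^{(2+ε_m)/3} ≤ |F|^m (no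
dimension-exact frame design in bounded rank). -/
@[route_item "route-MatrixMultiplication-AlgebraicSTPPDichotomy"]
def FrameBarrier : Prop :=
  ∀ m : ℕ, ∃ ε : ℝ, 0 < ε ∧ ∃ q₀ : ℕ, ∀ (F : Type) [Field F] [Fintype F], q₀ ≤ Fintype.card F → ∀ (N : ℕ) (V W U : Fin N → Submodule F (Fin m → F)) (A B C : Fin N → Finset (Fin m → F)), (∀ i v, v ∈ A i ↔ v ∈ V i ∧ v ≠ 0) → (∀ i v, v ∈ B i ↔ v ∈ W i ∧ v ≠ 0) → (∀ i v, v ∈ C i ↔ v ∈ U i ∧ v ≠ 0) → Literature.Computability.AlgebraicComplexity.IsSTPP A B C → ∑ i, (((A i).card * (B i).card * (C i).card : ℕ) : ℝ) ^ ((2 + ε) / 3) ≤ (Fintype.card F : ℝ) ^ m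

/-- item stmt-MatrixMultiplication-9721 · target · rank 0 · closed · refuted by AlgebraicSTPPDichotomyExactFrameDesign_refuted @ 968c9d9e7f0e (refuter) · by planner
why it might fail: FrameBarrier (= ¬X) may simply hold: closed cases have O(1) blocks (m = 3: ≤ 2; lines in F^4: exactly 3 for q = 3,4,5, refuter census), big frames 5d > m force cliques in a Zariski-closed bad-pair graph, and over prime fields X would refute Pratt2024 Conj 4.1 (Cor 4.5, Val(ℤ_n)).
sources: CohnKleinbergSzegedyUmans2005, BlasiakChurchCohnGrochowNaslundSawinUmans2017, BlasiakCohnGrochowPrattUmans2023, Pratt2024, lean:Literature.Computability.AlgebraicComplexity.CohnKleinbergSzegedyUmans2005_5_5_abelian_holds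
[target] X (D-0027 route-repair 2026-08-15: the DECIDING side of the dichotomy becomes the target;
thesis-header rewrite + deciding theorem closes pending a tenure edit, package attached as item
evidence): some rank m such that for every ε > 0 and arbitrarily large finite fields F there is an
STPP family of punctured-subspace frames in F^m with Σ_i (|A_i||B_i||C_i|)^{(2+ε)/3} > |F|^m — a
dimension-exact STPP frame design in bounded rank; the positive form of ¬FrameBarrier (support
FrameBarrierIffNotExact). Decides the summit: closes : ExactFrameDesign → MatrixMultiplication via
CKSU Thm 5.5 (tree theorem CohnKleinbergSzegedyUmans2005_5_5_abelian_holds) with ε = ω − 2 and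
omega_two_le (proved sorry-free in the repair planner's Sketch.lean). why it might fail:
FrameBarrier (= ¬X) may simply be true — every closed case has ≤ 2 full blocks (m = 3; (2,1,1) in
F^4), big frames 5d > m force cliques in a Zariski-closed bad-pair graph, and no STPP family meeting
even the packing bound is known in any abelian group (BlasiakCohnGrochowPrattUmans2023 p. 3).
sources: CohnKleinbergSzegedyUmans2005 Thm 5.5, BlasiakChurchCohnGrochowNaslundSawinUmans2017 Lemma
2.4 / Thm B, BlasiakCohnGrochowPrattUm -/
@[route_item "route-MatrixMultiplication-AlgebraicSTPPDichotomy"]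
def ExactFrameDesign : Prop :=
  ∃ m : ℕ, ∀ ε : ℝ, 0 < ε → ∀ q₀ : ℕ, ∃ (F : Type) (_ : Field F) (_ : Fintype F), q₀ ≤ Fintype.card F ∧ ∃ (N : ℕ) (V W U : Fin N → Submodule F (Fin m → F)) (A B C : Fin N → Finset (Fin m → F)), (∀ i v, v ∈ A i ↔ v ∈ V i ∧ v ≠ 0) ∧ (∀ i v, v ∈ B i ↔ v ∈ W i ∧ v ≠ 0) ∧ (∀ i v, v ∈ C i ↔ v ∈ U i ∧ v ≠ 0) ∧ Literature.Computability.AlgebraicComplexity.IsSTPP A B C ∧ (Fintype.card F : ℝ) ^ m < ∑ i, (((A i).card * (B i).card * (C i).card : ℕ) : ℝ) ^ ((2 + ε) / 3)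

/-- item stmt-MatrixMultiplication-7621 · crux · rank 2 · closed · moot by None · by planner
why it might fail: The global-degeneracy cascade is closed only for m = 3 and (2,1,1) in F^4; from (m,d,e) = (4,1,2), (5,1,3), (6,2,2) on a parametrised degenerate-but-consistent configuration may exist — and would give ω = 2.
sources: CohnKleinbergSzegedyUmans2005, ChatzidakisVanDenDriesMacintyre1992, Tao2015AlgebraicRegularity, LangWeil1954
[crux] card Crux 1 (linear case) in counting form, the case where the irreducibility engine applies:
for bounded-degree polynomial frame families over F — index set the F-points of a basic open {f = 0,
g ≠ 0} ⊂ A^e, sets the punctured column spans of polynomial matrices M_A(x), M_B(x), M_C(x) — STPP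
on ALL index points forces Σ_x (|A_x||B_x||C_x|)^{(2+ε)/3} ≤ |F|^m for |F| ≥ q₀, with ε, q₀
depending only on (degree, e, m, d_A, d_B, d_C, r): no dimension-exact ALGEBRAIC frame design.
Implied by FrameBarrier and by DefinableDesignBarrier; equivalent to FrameBarrier in the big-frame
regime 5d > m via the clique-to-subvariety reduction (layer 2). [difficulty: open-problem] -/
@[route_item "route-MatrixMultiplication-AlgebraicSTPPDichotomy"]
def AlgebraicFrameBarrier : Prop :=
  ∀ (D e m dA dB dC r : ℕ), ∃ ε : ℝ, 0 < ε ∧ ∃ q₀ : ℕ, ∀ (F : Type) [Field F] [Fintype F], q₀ ≤ Fintype.card F → ∀ (f : Fin r → MvPolynomial (Fin e) F) (g : MvPolynomial (Fin e) F) (MA : Matrix (Fin m) (Fin dA) (MvPolynomial (Fin e) F)) (MB : Matrix (Fin m) (Fin dB) (MvPolynomial (Fin e) F)) (MC : Matrix (Fin m) (Fin dC) (MvPolynomial (Fin e) F)), (∀ j, (f j).totalDegree ≤ D) → g.totalDegree ≤ D → (∀ i j, (MA i j).totalDegree ≤ D) → (∀ i j, (MB i j).totalDegree ≤ D) → (∀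 i j, (MC i j).totalDegree ≤ D) → ∀ (I : Finset (Fin e → F)) (A B C : (Fin e → F) → Finset (Fin m → F)), (∀ x, x ∈ I ↔ (∀ j, MvPolynomial.eval x (f j) = 0) ∧ MvPolynomial.eval x g ≠ 0) → (∀ x v, v ∈ A x ↔ v ∈ LinearMap.range (Matrix.mulVecLin (MA.map (MvPolynomial.eval x))) ∧ v ≠ 0) → (∀ x v, v ∈ B x ↔ v ∈ LinearMap.range (Matrix.mulVecLin (MB.map (MvPolynomial.eval x))) ∧ v ≠ 0) → (∀ x v, v ∈ C x ↔ v ∈ LinearMap.range (Matrix.mulVecLin (MC.map (MvPolynomial.eval x))) ∧ v ≠ 0) → (∀ (N : ℕ) (ι : Fin N → (Fin e → F)), Function.Injective ι → (∀ i, ι i ∈ I) → Literature.Computability.AlgebraicComplexity.IsSTPP (fun i => A (ι i)) (fun i => B (ι i)) (fun i => C (ι i))) → ∑ x ∈ I, (((A x).card * (B x).card * (C x).card : ℕ) : ℝ) ^ ((2 + ε) / 3) ≤ (Fintype.card F : ℝ) ^ m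

/-- item stmt-MatrixMultiplication-9732 · crux · rank 2 · closed · refuted by Summit.MatrixMultiplication.MatrixMultiplication.Theorems.AlgebraicSTPPDichotomyExactLineDesign_refuted @ 4274edbc8f06 (refuter) · by planner
why it might fail: LineFrameBarrier may hold: m = 3 has ≤ 2 blocks, lines in F^4 have exactly 3 for q = 3,4,5 (refuter census), a random family in F^6 has ~q^6 bad pairs at N = q^4, and no packing-saturating STPP design is known in abelian groups of bounded rank (BCGPU2023 p. 4: none even in groups of Lie type).
sources: CohnKleinbergSzegedyUmans2005, BlasiakChurchCohnGrochowNaslundSawinUmans2017, BlasiakCohnGrochowPrattUmans2023, Pratt2024, lean:Literature.Computability.AlgebraicComplexity.IsSTPP.packing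
[crux] CONSTRUCTION (D-0027 route-repair 2026-08-15), the line case d = (1,1,1) of the target
ExactFrameDesign in counting form: some m such that for every δ > 0 and arbitrarily large finite F
there are N ≥ |F|^{m−2−δ} triples of punctured lines (F^× a_i, F^× b_i, F^× c_i), a_i, b_i, c_i ≠ 0
in F^m, forming an STPP family (packing allows N ≲ q^{m−2}: three mutually indexed near-spreads).
First candidate home m = 6 over prime fields F_p (generic triples good; the torus ker(N: F_{p^6}^× →
F_{p^2}^×) packs one pairing perfectly); Thm B (tree) forces char F → ∞ along witnesses, which
bounded rank allows. Implies the target (support LineDesignToExact). Hardest and most informative.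
why it might fail: LineFrameBarrier may hold — m = 3 has ≤ 2 blocks (RankThreeNoGo), m = 4, 5 are
clique problems in a Zariski-closed bad-pair graph, a random family in F^6 has ~q^6 bad pairs at N =
q^4, and no packing-bound STPP family is known in any abelian group
(BlasiakCohnGrochowPrattUmans2023 p. 3). sources: CohnKleinbergSzegedyUmans2005 Def 5.1 / §5,
BlasiakChurchCohnGrochowNaslundSawinUmans2017 Lemma 2.4, BlasiakCohnGrochowPrattUmans2023,
Pratt2024, lean:Literature.Computability.AlgebraicComplexity.I -/
@[route_item "route-MatrixMultiplication-AlgebraicSTPPDichotomy"]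
def ExactLineDesign : Prop :=
  ∃ m : ℕ, ∀ δ : ℝ, 0 < δ → ∀ q₀ : ℕ, ∃ (F : Type) (_ : Field F) (_ : Fintype F), q₀ ≤ Fintype.card F ∧ ∃ (N : ℕ) (a b e : Fin N → (Fin m → F)) (A B C : Fin N → Finset (Fin m → F)), (∀ i, a i ≠ 0 ∧ b i ≠ 0 ∧ e i ≠ 0) ∧ (∀ i v, v ∈ A i ↔ v ≠ 0 ∧ ∃ t : F, v = t • a i) ∧ (∀ i v, v ∈ B i ↔ v ≠ 0 ∧ ∃ t : F, v = t • b i) ∧ (∀ i v, v ∈ C i ↔ v ≠ 0 ∧ ∃ t : F, v = t • e i) ∧ Literature.Computability.AlgebraicComplexity.IsSTPP A B C ∧ (Fintype.card F : ℝ) ^ ((m : ℝ) - 2 - δ) ≤ (N : ℝ)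

/-- item stmt-MatrixMultiplication-7622 · crux · rank 3 · closed · moot by None · by planner
why it might fail: m = 4, 5 need a power saving for cliques of line-triples under 5- and 6-vector coplanarity constraints (open); for m ≥ 6 generic triples are GOOD and q^(m−2) blocks is a packing question where a field-extension torus already packs one of the three pairings perfectly.
sources: CohnKleinbergSzegedyUmans2005, BlasiakChurchCohnGrochowNaslundSawinUmans2017, Pratt2024
[crux] the d = (1,1,1) case of X for ALL families: for every m some ε_m > 0, q₀ with Σ_i
(|A_i||B_i||C_i|)^{(2+ε_m)/3} ≤ |F|^m for every STPP family of punctured LINES in F^m, |F| ≥ q₀;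
i.e. at most q^{m−2−δ} STPP line-triples (packing allows q^{m−2}). m = 3 is RankThreeNoGo; first
open numerologies (4,1,2), (5,1,3) (big-frame regime, cliques under 6-vector degeneracies), then m ≥
6 (spread regime). [deps: RankThreeNoGo] [difficulty: L] -/
@[route_item "route-MatrixMultiplication-AlgebraicSTPPDichotomy"]
def LineFrameBarrier : Prop :=
  ∀ m : ℕ, ∃ ε : ℝ, 0 < ε ∧ ∃ q₀ : ℕ, ∀ (F : Type) [Field F] [Fintype F], q₀ ≤ Fintype.card F → ∀ (N : ℕ) (a b c : Fin N → (Fin m → F)) (A B C : Fin N → Finset (Fin m → F)), (∀ i v, v ∈ A i ↔ v ≠ 0 ∧ ∃ t : F, v = t • a i) → (∀ i v, v ∈ B i ↔ v ≠ 0 ∧ ∃ t : F, v = t • b i) → (∀ i v, v ∈ C i ↔ v ≠ 0 ∧ ∃ t : F, v = t • c i) → Literature.Computability.AlgebraicComplexity.IsSTPP A B C → ∑ i, (((A i).card * (B i).card * (C i).card : ℕ) : ℝ) ^ ((2 + ε) / 3) ≤ (Fintype.card F : ℝ) ^ m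

/-- item stmt-MatrixMultiplication-7623 · crux · rank 4 · closed · moot by None · by planner
why it might fail: Every closed case has O(1) full blocks (m = 3: ≤ 2; (2,1,1) in F^4: ≤ 2; lines in F^4: 3), e = 0 designs give w_inf ≥ 3, and no packing-saturating STPP design is known in any abelian group of bounded rank or exponent (BCGPU2023 p. 4; Thm B) — the frame spectrum may be {3}.
sources: CohnKleinbergSzegedyUmans2005, BlasiakCohnGrochowPrattUmans2023, BlasiakChurchCohnGrochowNaslundSawinUmans2017
[crux] POSITIVE RESIDUE (card Crux 3), existential: some m and τ ∈ [2,3) such that for arbitrarily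
large finite fields F there is an STPP frame family in F^m with Σ_i (|A_i||B_i||C_i|)^{τ/3} ≥ |F|^m
— a bounded-rank group-theoretic certificate below 3 at POWER level (CKSU's e = 0 designs reach only
w_inf = 3; this needs index growth q^e with e > m − v, heavily overlapping frames). Two-sided: a
witness is the first such certificate and locates inf Spec(w_inf); its negation proves FrameBarrier
outright (support NotSubcubicToBarrier). [difficulty: L] -/
@[route_item "route-MatrixMultiplication-AlgebraicSTPPDichotomy"]
def SubcubicFrameFamily : Prop :=
  ∃ (m : ℕ) (τ : ℝ), 2 ≤ τ ∧ τ < 3 ∧ ∀ q₀ : ℕ, ∃ (F : Type) (_ : Field F) (_ : Fintype F), q₀ ≤ Fintype.card F ∧ ∃ (N : ℕ) (V W U : Fin N → Submodule F (Fin m → F)) (A B C : Fin N → Finset (Fin m → F)), (∀ i v, v ∈ A i ↔ v ∈ V i ∧ v ≠ 0) ∧ (∀ i v, v ∈ B i ↔ v ∈ W i ∧ v ≠ 0) ∧ (∀ i v, v ∈ C i ↔ v ∈ U i ∧ v ≠ 0) ∧ Literature.Computability.AlgebraicComplexity.IsSTPP A B C ∧ (Fintype.card F : ℝ) ^ m ≤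 ∑ i, (((A i).card * (B i).card * (C i).card : ℕ) : ℝ) ^ (τ / 3)

/-- item stmt-MatrixMultiplication-7624 · crux · rank 5 · closed · moot by None · by planner
why it might fail: The coset step is conjectural: a definable non-coset design (tori minus hypersurfaces, norm-one sets, quadratic-residue patterns) could be dimension-exact where frames are not; CDM densities μ < 1 only enter at w_inf itself.
sources: ChatzidakisVanDenDriesMacintyre1992, Tao2015AlgebraicRegularity, CohnKleinbergSzegedyUmans2005, arXiv:1005.1881
[crux] the card's full layer (its Crux 2 folded in): for ring-language formulas φ_I(x;y), φ_A, φ_B,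
φ_C(x,v;y) (parameters y ∈ F^k) there are ε > 0, q₀ such that in every finite field F with |F| ≥ q₀
and for every parameter value, if the definable family (A_x, B_x, C_x)_{x ∈ I(F)} ⊂ F^m is STPP on
all of I(F) then Σ_{x∈I(F)} (|A_x||B_x||C_x|)^{(2+ε)/3} ≤ |F|^m. Route to it: CDM main theorem makes
the count dimension arithmetic; dimension-exactness forces maximal degeneracy of the bad variety; a
coset theorem (group configuration / Breuillard–Green–Tao / Tao's algebraic regularity lemma) should
reduce exact definable designs to frames, i.e. to AlgebraicFrameBarrier. Covers tori (F^×)^d and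
CKSU §7 local designs, which frames do not. [deps: AlgebraicFrameBarrier] [difficulty: XL] -/
@[route_item "route-MatrixMultiplication-AlgebraicSTPPDichotomy"]
def DefinableDesignBarrier : Prop :=
  ∀ (e m k : ℕ) (φI : FirstOrder.Language.ring.Formula (Fin e ⊕ Fin k)) (φA φB φC : FirstOrder.Language.ring.Formula ((Fin e ⊕ Fin m) ⊕ Fin k)), ∃ ε : ℝ, 0 < ε ∧ ∃ q₀ : ℕ, ∀ (F : Type) [Field F] [Fintype F] [FirstOrder.Ring.CompatibleRing F], q₀ ≤ Fintype.card F → ∀ (y : Fin k → F) (I : Finset (Fin e → F)) (A B C : (Fin e → F) → Finset (Fin m → F)), (∀ x, x ∈ I ↔ φI.Realize (Sum.elim x y)) → (∀ x v, v ∈ A x ↔ φA.Realize (Sum.elim (Sum.elim x v) y)) → (∀ x v, v ∈ B x ↔ φB.Realize (Sum.elim (Sum.elim x v) y)) → (∀ x v, v ∈ C x ↔ φC.Realize (Sum.elim (Sum.elim x v) y)) → (∀ (N : ℕ) (ι : Fin N → (Fin e → F)), Function.Injective ι → (∀ i, ι i ∈ I) → Literature.Computability.AlgebraicComplexity.IsSTPP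 (fun i => A (ι i)) (fun i => B (ι i)) (fun i => C (ι i))) → ∑ x ∈ I, (((A x).card * (B x).card * (C x).card : ℕ) : ℝ) ^ ((2 + ε) / 3) ≤ (Fintype.card F : ℝ) ^ m

/-- item stmt-MatrixMultiplication-7625 · support · rank 9 · closed · moot by None · by planner
sources: CohnKleinbergSzegedyUmans2005
[support] provable now (hand proof in planner NOTES.md): over a finite field with |F| ≥ 5, an STPP
family of punctured-subspace frames in F^3 has at most 2 blocks with all three sets non-empty
(patterns (x,x,y), (x,y,y), (x,y,x) force the plane-triples of two full blocks to be cyclic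
rotations of each other; three rotations violate the all-distinct pattern; CKSU §5 example attains
2). Gives LineFrameBarrier and FrameBarrier at m = 3 with any ε_3 ≤ 1/2. [difficulty: provable-now] -/
@[route_item "route-MatrixMultiplication-AlgebraicSTPPDichotomy"]
def RankThreeNoGo : Prop :=
  ∀ (F : Type) [Field F] [Fintype F], 5 ≤ Fintype.card F → ∀ (N : ℕ) (V W U : Fin N → Submodule F (Fin 3 → F)) (A B C : Fin N → Finset (Fin 3 → F)), (∀ i v, v ∈ A i ↔ v ∈ V i ∧ v ≠ 0) → (∀ i v, v ∈ B i ↔ v ∈ W i ∧ v ≠ 0) → (∀ i v, v ∈ C i ↔ v ∈ U i ∧ v ≠ 0) → Literature.Computability.AlgebraicComplexity.IsSTPP A B C → (Finset.univ.filter (fun i => (A i).Nonempty ∧ (B i).Nonempty ∧ (C i).Nonempty)).card ≤ 2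

/-- item stmt-MatrixMultiplication-7626 · support · rank 9 · closed · moot by None · by planner
sources: CohnKleinbergSzegedyUmans2005
[support] glue, provable now: ¬SubcubicFrameFamily → FrameBarrier (take τ = 5/2, ε = 1/2; push the
negation through and compare exponents). [difficulty: provable-now] -/
@[route_item "route-MatrixMultiplication-AlgebraicSTPPDichotomy"]
def NotSubcubicToBarrier : Prop :=
  ¬ SubcubicFrameFamily → FrameBarrier

/-- item stmt-MatrixMultiplication-7627 · support · rank 9 · closed · moot by None · by planner
sources: CohnKleinbergSzegedyUmans2005
[support] glue, provable now: FrameBarrier → LineFrameBarrier (a punctured line {t • a : t ≠ 0} is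
the punctured span F∙a; `Submodule.mem_span_singleton`). [difficulty: provable-now] -/
@[route_item "route-MatrixMultiplication-AlgebraicSTPPDichotomy"]
def FrameToLine : Prop :=
  FrameBarrier → LineFrameBarrier

/-- item stmt-MatrixMultiplication-7628 · support · rank 9 · closed · moot by None · by planner
sources: CohnKleinbergSzegedyUmans2005, lean:Literature.Computability.AlgebraicComplexity.CohnKleinbergSzegedyUmans2005_5_5_abelian_holds
[support] provable now, the kill link of the definable layer: CKSU Thm 5.5 (tree fact, proved) →
¬DefinableDesignBarrier → ω(ℂ) = 2 (re-index I(F) by Fin |I|, take ε = ω − 2, |F^m| = |F|^m,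
`omega_two_le`). [difficulty: provable-now] -/
@[route_item "route-MatrixMultiplication-AlgebraicSTPPDichotomy"]
def DefinableKillLink : Prop :=
  Literature.Computability.AlgebraicComplexity.CohnKleinbergSzegedyUmans2005_5_5_abelian → ¬ DefinableDesignBarrier → MatrixMultiplication

/-- item stmt-MatrixMultiplication-9752 · support · rank 9 · closed · moot by None · by planner
sources: CohnKleinbergSzegedyUmans2005, lean:Literature.Computability.AlgebraicComplexity.IsSTPP
[support] glue, provable now (D-0027 route-repair): ExactLineDesign → ExactFrameDesign. V_i = F∙a_i
etc. (Submodule.mem_span_singleton), |A_i| = |B_i| = |C_i| = |F| − 1 since a_i ≠ 0, so Σ =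
N(|F|−1)^{2+ε}; take δ := ε/2: N ≥ |F|^{m−2−ε/2} gives Σ ≥ 2^{−(2+ε)}|F|^{m+ε/2} > |F|^m once |F| >
2^{2(2+ε)/ε} (choose q₀ accordingly). sources: CohnKleinbergSzegedyUmans2005 Def 5.1. [difficulty:
provable-now] -/
@[route_item "route-MatrixMultiplication-AlgebraicSTPPDichotomy"]
def LineDesignToExact : Prop :=
  ExactLineDesign → ExactFrameDesign

/-- item stmt-MatrixMultiplication-9753 · support · rank 9 · closed · moot by None · by planner
sources: CohnKleinbergSzegedyUmans2005
[support] bookkeeping, provable now (pure logic: push_neg, not_lt; proved in the repair planner's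
Scratch.lean): FrameBarrier ↔ ¬ExactFrameDesign — the route is decided by exactly one of the target
and its negative side FrameBarrier; a proof of FrameBarrier is a one-line refutation of the target.
sources: CohnKleinbergSzegedyUmans2005. [difficulty: provable-now] -/
@[route_item "route-MatrixMultiplication-AlgebraicSTPPDichotomy"]
def FrameBarrierIffNotExact : Prop :=
  FrameBarrier ↔ ¬ ExactFrameDesign

/-- item stmt-MatrixMultiplication-9754 · support · rank 9 · closed · moot by None · by planner
sources: CohnKleinbergSzegedyUmans2005
[support] bookkeeping, provable now (proved in the repair planner's Scratch.lean): ExactFrameDesign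
→ SubcubicFrameFamily with τ = 5/2 (apply the target with ε = 1/2; (2 + 1/2)/3 = (5/2)/3; < gives ≤)
— the positive residue is a necessary waypoint of the target. sources:
CohnKleinbergSzegedyUmans2005. [difficulty: provable-now] -/
@[route_item "route-MatrixMultiplication-AlgebraicSTPPDichotomy"]
def ExactToSubcubic : Prop :=
  ExactFrameDesign → SubcubicFrameFamily

-- earlier Assembly (stmt-MatrixMultiplication-7629, replaced 2026-08-15T16:13:56Z -> stmt-MatrixMultiplication-10387): retired by None — Literature.Computability.AlgebraicComplexity.CohnKleinbergSzegedyUmans2005_5_5_abelian → ¬ FrameBarrier → MatrixMultiplication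
/-- item stmt-MatrixMultiplication-10387 · assembly · rank 1 · closed · moot by None · by planner
sources: CohnKleinbergSzegedyUmans2005, Blaser2013, lean:Literature.Computability.AlgebraicComplexity.CohnKleinbergSzegedyUmans2005_5_5_abelian_holds, lean:Literature.Computability.AlgebraicComplexity.omega_two_le
[assembly] the kill link of the dichotomy in its honest one-hypothesis form: a dimension-exact STPP
design of punctured-subspace frames in bounded rank (the target ExactFrameDesign = ¬FrameBarrier,
item FrameBarrierIffNotExact) gives ω(ℂ) = 2 — apply CKSU 2005 Thm 5.5 (abelian case; PROVED in
tree: CohnKleinbergSzegedyUmans2005_5_5_abelian_holds) in H = F^m with ε = ω − 2 and omega_two_le.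
Literally the type of the route's deciding theorem `closes` (sorry-free in the route file), hence
provable now by `fun h => closes h`. Supersedes the old form `CKSU_5_5_abelian → ¬FrameBarrier →
MatrixMultiplication` (non-item hypotheses; glue.extra-hypothesis). sources:
CohnKleinbergSzegedyUmans2005 Thm 5.5, Blaser2013 Def 5.1,
lean:Literature.Computability.AlgebraicComplexity.CohnKleinbergSzegedyUmans2005_5_5_abelian_holds,
lean:Literature.Computability.AlgebraicComplexity.omega_two_le. [difficulty: provable-now] -/
@[route_item "route-MatrixMultiplication-AlgebraicSTPPDichotomy"]
def Assembly : Prop :=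
  ExactFrameDesign → MatrixMultiplication

end Summit.MatrixMultiplication.MatrixMultiplication.Theses.AlgebraicSTPPDichotomy
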